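import Summits.KontsevichZagierPeriods.KontsevichZagierPeriods.Theorems.SoloBlindTriplication
import Literature.NumberTheory.Transcendental.KZBetaChains
import HarnessLib

/-!
# Solo/blind — Triplication III: the second kind is one-dimensional (`3a+b=2`, any `a > 0`)

The pull-back of `β(a,b)` (`3a+b=2`) along `t = Ψ(u)` is `3^{b-1}·P(u)` with
`P = u^{2a-2} q^{b-3} (1-q²)`, `q = (1-u)^{1/3}` (`tri_pullback1`).  For `a > 1/2` the two
monomials of `P` are integrable and split termwise (`betaQ_tripl1`).  For `0 < a ≤ 1/2` (the
genuinely second-kind range `1/3 < a < 1/2` included) they are not, but ONE Newton–Leibniz move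
repairs this: with the `ℚ`-semialgebraic, continuous primitive

  `ρ(u) = u^{2a} q^b (1+q)/(1+q+q²) = u^{2a-1} q^b (1-q²)`,  `ρ(0) = ρ(1) = 0`,

one has on `(0,1)`

  `ρ' = (2a-1)·P + W`,  `W = ((1-3a)/3)·u^{2a-1}q^{b-3} + ((1+3a)/3)·u^{2a-1}q^{b-1}`,

and both monomials of `W` are honest Beta integrands.  Hence, inside the KZ rules
(one substitution, one rule (3), two additivity splits, no division):

  `(1-2a)·β(a,b) = 3^{b-1}·[ ((1-3a)/3)·β(2a, b/3) + ((1+3a)/3)·β(2a, (b+2)/3) ]`.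

At level `9` (`a = 4/9`): `(1/9)β(4/9,2/3) = 3^{-1/3}[-(1/9)β(8/9,2/9) + (7/9)β(8/9,8/9)]`,
the Deligne–Koblitz–Ogus merge `{4,6,8} ~ {8,8,2}` of second-kind orbits.
-/

namespace Summit.KontsevichZagierPeriods.KontsevichZagierPeriods.Theorems

open Literature.NumberTheory.Transcendental Literature.NumberTheory.Transcendental.KZ
open Literature.NumberTheory.Transcendental.KZ.IntegralRep
open Literature.ModelTheory.ExponentialFields
open MeasureTheory Set Real Polynomial

noncomputable section

namespace SoloBlind

variable {a b : ℚ}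

/-! ## Semialgebraicity and integrability without sign conditions -/

/-- `t^{a-1}(1-t)^{b-1}` is `ℚ`-semialgebraic on `(0,1)` for all rational `a, b`. -/
theorem isSemialgebraicFunOn_betaFun' (a b : ℚ) :
    IsSemialgebraicFunOn ℚ (line (Ioo (0:ℝ) 1)) (fun x : Fin 1 → ℝ => betaFun a b (x 0)) :=
  (isSemialgebraicFunOn_const_mul_rpow_mul_rpow 1 (a - 1) (b - 1)).congr fun x _ => by
    simp only [betaFun]; push_cast; ring

/-- The pull-back of any Beta integrand along `Ψ` is integrable on `(0,1)` (change of variables). -/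
theorem integrableOn_triPull (a b : ℚ) (ha : 0 < a) (hb : 0 < b) :
    IntegrableOn (fun u => betaFun a b (triPsi u) * |triPsi' u|) (Ioo 0 1) := by
  have h := (integrableOn_image_iff_integrableOn_abs_deriv_smul measurableSet_Ioo
    (fun u (hu : u ∈ Ioo (0:ℝ) 1) => (hasDerivAt_triPsi hu.2).hasDerivWithinAt) injOn_triPsi
    (betaFun a b)).mp (by rw [← image_triPsi]; exact integrableOn_betaFun a b ha hb)
  exact h.congr_fun (fun u _ => by simp only [smul_eq_mul, mul_comm]) measurableSet_Ioo

/-- `3^{b-1}(h₁ - h₂)` is integrable on `(0,1)` whenever `a, b > 0`, `3a+b=2`. -/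
theorem integrableOn_triF1' (a b : ℚ) (ha : 0 < a) (hb : 0 < b) (h : 3 * a + b = 2) :
    IntegrableOn (triF1 a b) (Ioo 0 1) :=
  (integrableOn_triPull a b ha hb).congr_fun (fun _ hu => (tri_pullback1 a b h hu).symm)
    measurableSet_Ioo

/-- `3^{b-1}(h₁ - h₂)` is `ℚ`-semialgebraic on `(0,1)`, any `a, b`. -/
theorem isSemialgebraicFunOn_triF1' (a b : ℚ) :
    IsSemialgebraicFunOn ℚ (line (Ioo (0:ℝ) 1)) (fun x : Fin 1 → ℝ => triF1 a b (x 0)) :=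
  IsSemialgebraicFunOn.mul_holds
    (isSemialgebraicFunOn_const_of_isAlgebraic mix_line_sa (tri_coeff_isAlgebraic b))
    (IsSemialgebraicFunOn.sub_holds (isSemialgebraicFunOn_betaFun' (2 * a - 1) (b / 3))
      (isSemialgebraicFunOn_betaFun' (2 * a - 1) ((b + 2) / 3)))

/-! ## The integrands `P`, `W` and the primitive `ρ` -/

/-- `P = h₁ - h₂ = u^{2a-2} q^{b-3} (1 - q²)`. -/
def triP1 (a b : ℚ) (u : ℝ) : ℝ :=
  betaFun (2 * a - 1) (b / 3) u - betaFun (2 * a - 1) ((b + 2) / 3) u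

/-- `W = ((1-3a)/3) u^{2a-1} q^{b-3} + ((1+3a)/3) u^{2a-1} q^{b-1}`. -/
def triW1 (a b : ℚ) (u : ℝ) : ℝ :=
  (((1 - 3 * a) / 3 : ℚ) : ℝ) * betaFun (2 * a) (b / 3) u +
    (((1 + 3 * a) / 3 : ℚ) : ℝ) * betaFun (2 * a) ((b + 2) / 3) u

/-- The primitive `ρ(u) = u^{2a} q^b (1+q)/(1+q+q²)`, in manifestly continuous form. -/
def triRho1 (a b : ℚ) (u : ℝ) : ℝ :=
  u ^ (2 * (a : ℝ)) * (triQ u ^ (b : ℝ) * ((1 + triQ u) / (1 + triQ u + triQ u * triQ u)))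

/-- The exact integrand `ρ' = (2a-1) P + W` on `(0,1)`, extended by `0`. -/
def triE1 (a b : ℚ) (u : ℝ) : ℝ :=
  if u ∈ Ioo (0:ℝ) 1 then (((2 * a - 1 : ℚ)) : ℝ) * triP1 a b u + triW1 a b u else 0

/-- `P` is integrable on `(0,1)` (`a, b > 0`, `3a+b=2`). -/
theorem integrableOn_triP1 (a b : ℚ) (ha : 0 < a) (hb : 0 < b) (h : 3 * a + b = 2) :
    IntegrableOn (triP1 a b) (Ioo 0 1) := by
  have h3 : (3:ℝ) ^ ((b : ℝ) - 1) ≠ 0 := (Real.rpow_pos_of_pos (by norm_num) _).ne'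
  refine IntegrableOn.congr_fun ((integrableOn_triF1' a b ha hb h).div_const
    ((3:ℝ) ^ ((b : ℝ) - 1))) (fun u _ => ?_) measurableSet_Ioo
  simp only [triF1, triP1]
  rw [mul_div_cancel_left₀ _ h3]

/-- `P` is `ℚ`-semialgebraic on `(0,1)`. -/
theorem sa_triP1 (a b : ℚ) :
    IsSemialgebraicFunOn ℚ (line (Ioo (0:ℝ) 1)) (fun x : Fin 1 → ℝ => triP1 a b (x 0)) :=
  IsSemialgebraicFunOn.sub_holds (isSemialgebraicFunOn_betaFun' (2 * a - 1) (b / 3))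
    (isSemialgebraicFunOn_betaFun' (2 * a - 1) ((b + 2) / 3))

/-- `W` is integrable on `(0,1)` (`a, b > 0`). -/
theorem integrableOn_triW1 (a b : ℚ) (ha : 0 < a) (hb : 0 < b) :
    IntegrableOn (triW1 a b) (Ioo 0 1) :=
  ((integrableOn_betaFun (2 * a) (b / 3) (by positivity) (by positivity)).const_mul _).add
    ((integrableOn_betaFun (2 * a) ((b + 2) / 3) (by positivity) (by positivity)).const_mul _)

/-- `W` is `ℚ`-semialgebraic on `(0,1)`. -/
theorem sa_triW1 (a b : ℚ) :
    IsSemialgebraicFunOn ℚ (line (Ioo (0:ℝ) 1)) (fun x : Fin 1 → ℝ => triW1 a b (x 0)) :=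
  IsSemialgebraicFunOn.add_holds
    (IsSemialgebraicFunOn.mul_holds
      (isSemialgebraicFunOn_const_of_isAlgebraic mix_line_sa (isAlgebraic_rat ℚ _))
      (isSemialgebraicFunOn_betaFun' (2 * a) (b / 3)))
    (IsSemialgebraicFunOn.mul_holds
      (isSemialgebraicFunOn_const_of_isAlgebraic mix_line_sa (isAlgebraic_rat ℚ _))
      (isSemialgebraicFunOn_betaFun' (2 * a) ((b + 2) / 3)))

/-- `ρ(0) = 0` (`a > 0`). -/
theorem triRho1_zero (ha : 0 < a) : triRho1 a b 0 = 0 := by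
  have h2a : (2 * (a : ℝ)) ≠ 0 := by positivity
  simp [triRho1, Real.zero_rpow h2a]

/-- `ρ(1) = 0` (`b > 0`). -/
theorem triRho1_one (hb : 0 < b) : triRho1 a b 1 = 0 := by
  have hb' : (b : ℝ) ≠ 0 := by exact_mod_cast hb.ne'
  simp [triRho1, triQ_one, Real.zero_rpow hb']

/-- `ρ` is continuous on `ℝ` (`a, b > 0`). -/
theorem continuous_triRho1 (ha : 0 < a) (hb : 0 < b) : Continuous (triRho1 a b) := by
  have h2a : (0:ℝ) ≤ 2 * (a : ℝ) := by positivity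
  have hb' : (0:ℝ) ≤ (b : ℝ) := by exact_mod_cast hb.le
  unfold triRho1
  exact (Real.continuous_rpow_const h2a).mul
    ((continuous_triQ.rpow_const fun _ => Or.inr hb').mul
      ((continuous_const.add continuous_triQ).div
        ((continuous_const.add continuous_triQ).add (continuous_triQ.mul continuous_triQ))
        fun u => (tri_s_pos u).ne'))

/-- On `(0,1)`: `ρ = u^{2a-1}(1-u)^{b/3} - u^{2a-1}(1-u)^{(b+2)/3}`. -/
theorem triRho1_eq {u : ℝ} (hu : u ∈ Ioo (0:ℝ) 1) :
    triRho1 a b u = u ^ (2 * (a : ℝ) - 1) * (1 - u) ^ ((b : ℝ) / 3) -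
      u ^ (2 * (a : ℝ) - 1) * (1 - u) ^ (((b : ℝ) + 2) / 3) := by
  obtain ⟨h0, h1⟩ := hu
  unfold triRho1
  set q := triQ u with hq
  have hq0 : 0 < q := triQ_pos h1
  have hs : (0:ℝ) < 1 + q + q * q := by rw [hq]; exact tri_s_pos u
  have hus : u = (1 - q) * (1 + q + q * q) := by rw [hq]; exact tri_u_eq h1.le
  have e1 : (1 - u) ^ ((b : ℝ) / 3) = q ^ (b : ℝ) := by rw [hq, triQ_rpow h1.le]
  have e2 : (1 - u) ^ (((b : ℝ) + 2) / 3) = q ^ (b : ℝ) * q ^ 2 := by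
    rw [← Real.rpow_two, ← Real.rpow_add hq0, hq, triQ_rpow h1.le]
  have e3 : u ^ (2 * (a : ℝ)) = u ^ (2 * (a : ℝ) - 1) * u := by
    rw [← Real.rpow_add_one h0.ne']; congr 1; ring
  have key : u * ((1 + q) / (1 + q + q * q)) = 1 - q ^ 2 := by
    rw [hus]; field_simp; ring
  rw [e1, e2, e3]
  calc u ^ (2 * (a : ℝ) - 1) * u * (q ^ (b : ℝ) * ((1 + q) / (1 + q + q * q)))
      = u ^ (2 * (a : ℝ) - 1) * q ^ (b : ℝ) * (u * ((1 + q) / (1 + q + q * q))) := by ring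
    _ = _ := by rw [key]; ring

/-- **`ρ' = (2a-1) P + W` on `(0,1)`** (`3a+b=2`): the identity
`d/du [u^{2a-1} q^b (1-q²)] = (2a-1) u^{2a-2} q^{b-3}(1-q²) + ((1-3a)/3) u^{2a-1} q^{b-3}
 + ((1+3a)/3) u^{2a-1} q^{b-1}`, using `q³ = 1-u`. -/
theorem hasDerivAt_triRho1 (h : 3 * a + b = 2) {u : ℝ} (hu : u ∈ Ioo (0:ℝ) 1) :
    HasDerivAt (triRho1 a b) ((((2 * a - 1 : ℚ)) : ℝ) * triP1 a b u + triW1 a b u) u := by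
  obtain ⟨h0, h1⟩ := hu
  have hb : (b : ℝ) = 2 - 3 * a := by
    have := congrArg (fun x : ℚ => (x : ℝ)) h; push_cast at this; linarith
  have hF : triRho1 a b =ᶠ[nhds u] fun v => v ^ (2 * (a : ℝ) - 1) * (1 - v) ^ ((b : ℝ) / 3) -
      v ^ (2 * (a : ℝ) - 1) * (1 - v) ^ (((b : ℝ) + 2) / 3) :=
    Filter.eventually_iff_exists_mem.mpr ⟨Ioo 0 1, Ioo_mem_nhds h0 h1, fun v hv => triRho1_eq hv⟩
  refine (((hasDerivAt_rpow_mul_one_sub_rpow (a := 2 * (a : ℝ) - 1) (b := (b : ℝ) / 3)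
    ⟨h0, h1⟩).sub (hasDerivAt_rpow_mul_one_sub_rpow (a := 2 * (a : ℝ) - 1)
    (b := ((b : ℝ) + 2) / 3) ⟨h0, h1⟩)).congr_of_eventuallyEq hF).congr_deriv ?_
  set q := triQ u with hq
  have hq0 : 0 < q := triQ_pos h1
  have hq3 : q ^ 3 = 1 - u := by rw [hq]; exact triQ_cube h1.le
  set Y := q ^ ((b : ℝ) - 3) with hY
  have eB : (1 - u) ^ ((b : ℝ) / 3 - 1) = Y := by
    rw [hY, hq, triQ_rpow h1.le]; congr 1; ring
  have eA : (1 - u) ^ ((b : ℝ) / 3) = Y * q ^ 3 := by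
    rw [hY, ← Real.rpow_natCast q 3, ← Real.rpow_add hq0, hq, triQ_rpow h1.le]
    congr 1; push_cast; ring
  have eD : (1 - u) ^ (((b : ℝ) + 2) / 3 - 1) = Y * q ^ 2 := by
    rw [hY, ← Real.rpow_natCast q 2, ← Real.rpow_add hq0, hq, triQ_rpow h1.le]
    congr 1; push_cast; ring
  have eC : (1 - u) ^ (((b : ℝ) + 2) / 3) = Y * q ^ 5 := by
    rw [hY, ← Real.rpow_natCast q 5, ← Real.rpow_add hq0, hq, triQ_rpow h1.le]
    congr 1; push_cast; ring
  have eU : u ^ (2 * (a : ℝ) - 1) = u ^ (2 * (a : ℝ) - 1 - 1) * u := by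
    rw [← Real.rpow_add_one h0.ne']; congr 1; ring
  simp only [triP1, triW1, betaFun]
  push_cast
  rw [eA, eB, eC, eD, eU, hb]
  linear_combination (u ^ (2 * (a : ℝ) - 1 - 1) * Y * (2 * (a : ℝ) - 1) * (1 - q ^ 2)) * hq3

/-- `ρ` is `ℚ`-semialgebraic on `[0,1]` (via its monomial form on `(0,1)` and `ρ(0)=ρ(1)=0`). -/
theorem sa_triRho1 (ha : 0 < a) (hb : 0 < b) :
    IsSemialgebraicFunOn ℚ (line (Icc 0 1)) fun x => triRho1 a b (x 0) := by
  refine isSemialgebraicFunOn_Icc_of_Ioo ?_ 0 0 (fun x hx => ?_) (fun x hx => ?_)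
  · refine ((isSemialgebraicFunOn_const_mul_rpow_mul_rpow 1 (2 * a - 1) (b / 3)).fun_sub
      (isSemialgebraicFunOn_const_mul_rpow_mul_rpow 1 (2 * a - 1) ((b + 2) / 3))).congr
      fun x hx => ?_
    have hx' : x 0 ∈ Ioo (0 : ℝ) 1 := hx
    beta_reduce
    rw [triRho1_eq hx']
    push_cast
    ring
  · rw [hx, triRho1_zero ha, Rat.cast_zero]
  · rw [hx, triRho1_one hb, Rat.cast_zero]

/-- `ρ'` (extended by `0`) is `ℚ`-semialgebraic on `[0,1]`. -/
theorem sa_triE1 (a b : ℚ) :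
    IsSemialgebraicFunOn ℚ (line (Icc 0 1)) fun x => triE1 a b (x 0) := by
  refine isSemialgebraicFunOn_Icc_of_Ioo ?_ 0 0 (fun x hx => ?_) (fun x hx => ?_)
  · refine (((isSemialgebraicFunOn_const_of_isAlgebraic mix_line_sa
      (isAlgebraic_rat ℚ (2 * a - 1))).mul_holds (sa_triP1 a b)).add_holds (sa_triW1 a b)).congr
      fun x hx => ?_
    have hx' : x 0 ∈ Ioo (0 : ℝ) 1 := hx
    simp only [triE1, if_pos hx', Pi.add_apply, Pi.mul_apply]
  · have h0 : x 0 ∉ Ioo (0 : ℝ) 1 := fun h => by rw [hx] at h; exact lt_irrefl _ h.1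
    rw [triE1, if_neg h0, Rat.cast_zero]
  · have h0 : x 0 ∉ Ioo (0 : ℝ) 1 := fun h => by rw [hx] at h; exact lt_irrefl _ h.2
    rw [triE1, if_neg h0, Rat.cast_zero]

/-- `ρ'` is integrable on `[0,1]`. -/
theorem integrableOn_triE1 (a b : ℚ) (ha : 0 < a) (hb : 0 < b) (h : 3 * a + b = 2) :
    IntegrableOn (triE1 a b) (Icc 0 1) := by
  rw [integrableOn_Icc_iff_integrableOn_Ioo]
  exact IntegrableOn.congr_fun
    (((integrableOn_triP1 a b ha hb h).const_mul ((((2 * a - 1 : ℚ)) : ℝ))).add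
      (integrableOn_triW1 a b ha hb))
    (fun v hv => by simp only [triE1, if_pos hv, Pi.add_apply]) measurableSet_Ioo

/-! ## The representations -/

/-- `[(0,1), P]`. -/
def triPRep1 (a b : ℚ) (ha : 0 < a) (hb : 0 < b) (h : 3 * a + b = 2) : IntegralRep 1 :=
  lineRep (Ioo 0 1) (triP1 a b) mix_line_sa (sa_triP1 a b) (integrableOn_triP1 a b ha hb h)

/-- `[(0,1), W]`. -/
def triWRep1 (a b : ℚ) (ha : 0 < a) (hb : 0 < b) : IntegralRep 1 :=
  lineRep (Ioo 0 1) (triW1 a b) mix_line_sa (sa_triW1 a b) (integrableOn_triW1 a b ha hb)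

/-- The source `[(0,1), 3^{b-1} P]` (now for every `a > 0`). -/
def triSrc1' (a b : ℚ) (ha : 0 < a) (hb : 0 < b) (h : 3 * a + b = 2) : IntegralRep 1 :=
  lineRep (Ioo 0 1) (triF1 a b) mix_line_sa (isSemialgebraicFunOn_triF1' a b)
    (integrableOn_triF1' a b ha hb h)

/-- The source is `3^{b-1}` times `[(0,1), P]`, literally. -/
theorem triSrc1'_eq (a b : ℚ) (ha : 0 < a) (hb : 0 < b) (h : 3 * a + b = 2) :
    triSrc1' a b ha hb h = (triPRep1 a b ha hb h).constMul ((3:ℝ) ^ ((b : ℝ) - 1))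
      (tri_coeff_isAlgebraic b) :=
  IntegralRep.ext' rfl rfl

/-- **Move 1, the substitution `t = Ψ(u)`: `[(0,1), 3^{b-1}P] ≡ β(a,b)`.** -/
theorem triSrc1'_sub_betaRep (a b : ℚ) (ha : 0 < a) (hb : 0 < b) (h : 3 * a + b = 2) :
    of (triSrc1' a b ha hb h) - of (betaRep a b ha hb) ∈ relations := by
  unfold triSrc1' betaRep
  exact lineRep_subst triPsi triPsi' isSemialgebraicFunOn_triPsi
    (fun t ht => (hasDerivAt_triPsi ht.2).hasDerivWithinAt) injOn_triPsi image_triPsi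
    (fun t ht => tri_pullback1 a b h ht)

/-- `X = [[0,1], ρ']`. -/
def triExact1 (a b : ℚ) (ha : 0 < a) (hb : 0 < b) (h : 3 * a + b = 2) : IntegralRep 1 :=
  lineRep (Icc 0 1) (triE1 a b) (isSemialgebraic_line_Icc isAlgebraic_zero isAlgebraic_one)
    (sa_triE1 a b) (integrableOn_triE1 a b ha hb h)

/-- **Move 2, rule (3)**: `[[0,1], ρ'] ∈ relations`, since `ρ(1) - ρ(0) = 0`. -/
theorem triExact1_mem (a b : ℚ) (ha : 0 < a) (hb : 0 < b) (h : 3 * a + b = 2) :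
    of (triExact1 a b ha hb h) ∈ relations := by
  have h0 : triRho1 a b 1 - triRho1 a b 0 = 0 := by rw [triRho1_one hb, triRho1_zero ha, sub_zero]
  have h1 : of (triExact1 a b ha hb h) -
      of (constCell (triRho1 a b 1 - triRho1 a b 0) (by rw [h0]; exact isAlgebraic_zero)) ∈
      relations :=
    lineRep_newtonLeibniz isAlgebraic_zero isAlgebraic_one zero_le_one (triRho1 a b)
      (sa_triRho1 ha hb) (continuous_triRho1 ha hb).continuousOn
      fun t ht => by rw [triE1, if_pos ht]; exact hasDerivAt_triRho1 h ht
  have hc : of (constCell (triRho1 a b 1 - triRho1 a b 0) (by rw [h0]; exact isAlgebraic_zero)) ∈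
      relations := by
    rw [constCell_congr h0 (hβ := isAlgebraic_zero)]
    exact constCell_zero
  simpa using relations.add_mem h1 hc

/-- `X⁰ = [(0,1), ρ']`, the open restriction. -/
def triExact1O (a b : ℚ) (ha : 0 < a) (hb : 0 < b) (h : 3 * a + b = 2) : IntegralRep 1 :=
  (triExact1 a b ha hb h).restrict (line (Ioo 0 1)) mix_line_sa fun _ hx => Ioo_subset_Icc_self hx

/-- `[(0,1), ρ'] ∈ relations` (drop the null endpoints). -/
theorem triExact1O_mem (a b : ℚ) (ha : 0 < a) (hb : 0 < b) (h : 3 * a + b = 2) :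
    of (triExact1O a b ha hb h) ∈ relations := by
  have h1 : of (triExact1 a b ha hb h) - of (triExact1O a b ha hb h) ∈ relations := by
    refine IntegralRep.of_sub_of_restrict_mem_relations _ _ _ ?_
    show volume (line (Icc (0 : ℝ) 1) \ line (Ioo 0 1)) = 0
    rw [← show line (Icc (0 : ℝ) 1 \ Ioo 0 1) = line (Icc (0 : ℝ) 1) \ line (Ioo 0 1) from rfl,
      volume_line, Icc_sdiff_Ioo_same zero_le_one]
    exact (toFinite _).measure_zero _
  have h2 := relations.sub_mem (triExact1_mem a b ha hb h) h1
  rwa [sub_sub_cancel] at h2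

/-- **Move 3, rule (1b)**: `[(0,1), ρ'] ≡ (2a-1)•[(0,1),P] + [(0,1),W]`. -/
theorem triExact1O_sub_sub (a b : ℚ) (ha : 0 < a) (hb : 0 < b) (h : 3 * a + b = 2) :
    of (triExact1O a b ha hb h) -
      of ((triPRep1 a b ha hb h).constMul (((2 * a - 1 : ℚ)) : ℝ) (isAlgebraic_rat ℚ (2 * a - 1))) -
      of (triWRep1 a b ha hb) ∈ relations := by
  refine of_sub_sub_mem_relations_of_add rfl rfl fun x hx => ?_
  have hx' : x 0 ∈ Ioo (0 : ℝ) 1 := hx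
  simp only [triExact1O, IntegralRep.integrand_restrict, triExact1, lineRep_integrand,
    IntegralRep.integrand_constMul, triPRep1, triWRep1]
  rw [triE1, if_pos hx']

/-- **Move 4, rule (1b)**: `[(0,1), W] ≡ ((1-3a)/3)•β(2a, b/3) + ((1+3a)/3)•β(2a, (b+2)/3)`. -/
theorem triWRep1_sub_sub (a b : ℚ) (ha : 0 < a) (hb : 0 < b) (ha2 : 0 < 2 * a)
    (hb3 : 0 < b / 3) (hb23 : 0 < (b + 2) / 3) :
    of (triWRep1 a b ha hb) -
      of ((betaRep (2 * a) (b / 3) ha2 hb3).constMul ((((1 - 3 * a) / 3 : ℚ)) : ℝ)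
        (isAlgebraic_rat ℚ ((1 - 3 * a) / 3))) -
      of ((betaRep (2 * a) ((b + 2) / 3) ha2 hb23).constMul ((((1 + 3 * a) / 3 : ℚ)) : ℝ)
        (isAlgebraic_rat ℚ ((1 + 3 * a) / 3))) ∈ relations :=
  of_sub_sub_mem_relations_of_add rfl rfl fun _ _ => rfl

/-! ## Assembly in `Q` -/

/-- `β(a,b) = 3^{b-1} • [(0,1), P]` in `Q`. -/
theorem betaQ_eq_triCoeff_smul_P (a b : ℚ) (ha : 0 < a) (hb : 0 < b) (h : 3 * a + b = 2) :
    betaQ a b = triCoeff b • mkQ (of (triPRep1 a b ha hb h)) := by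
  rw [betaQ_eq ha hb, ← mkQ_eq_mkQ_iff.mpr (triSrc1'_sub_betaRep a b ha hb h), triSrc1'_eq,
    mkQ_constMul]
  rfl

/-- `(2a-1)•[(0,1),P] + [(0,1),W] = 0` in `Q`. -/
theorem triP1_add_triW1_eq_zero (a b : ℚ) (ha : 0 < a) (hb : 0 < b) (h : 3 * a + b = 2) :
    ((2 * a - 1 : ℚ) : K₀) • mkQ (of (triPRep1 a b ha hb h)) + mkQ (of (triWRep1 a b ha hb)) = 0 := by
  have h1 := relations.sub_mem (triExact1O_sub_sub a b ha hb h) (triExact1O_mem a b ha hb h)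
  have e : of (triExact1O a b ha hb h) -
      of ((triPRep1 a b ha hb h).constMul (((2 * a - 1 : ℚ)) : ℝ) (isAlgebraic_rat ℚ (2 * a - 1))) -
      of (triWRep1 a b ha hb) - of (triExact1O a b ha hb h) =
      -(of ((triPRep1 a b ha hb h).constMul (((2 * a - 1 : ℚ)) : ℝ)
          (isAlgebraic_rat ℚ (2 * a - 1))) + of (triWRep1 a b ha hb)) := by abel
  rw [e] at h1
  have h1' := relations.neg_mem h1
  rw [neg_neg] at h1'
  have h2 := mkQ_eq_zero_iff.mpr h1'
  rwa [map_add, mkQ_constMul_ratCast] at h2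

/-- `[(0,1),W] = ((1-3a)/3)•β(2a,b/3) + ((1+3a)/3)•β(2a,(b+2)/3)` in `Q`. -/
theorem mkQ_triWRep1 (a b : ℚ) (ha : 0 < a) (hb : 0 < b) :
    mkQ (of (triWRep1 a b ha hb)) = (((1 - 3 * a) / 3 : ℚ) : K₀) • betaQ (2 * a) (b / 3) +
      (((1 + 3 * a) / 3 : ℚ) : K₀) • betaQ (2 * a) ((b + 2) / 3) := by
  have ha2 : (0:ℚ) < 2 * a := by positivity
  have hb3 : (0:ℚ) < b / 3 := by positivity
  have hb23 : (0:ℚ) < (b + 2) / 3 := by positivity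
  have h1 := triWRep1_sub_sub a b ha hb ha2 hb3 hb23
  rw [sub_sub] at h1
  have h2 := mkQ_eq_mkQ_iff.mpr h1
  rwa [map_add, mkQ_constMul_ratCast, mkQ_constMul_ratCast, ← betaQ_eq ha2 hb3,
    ← betaQ_eq ha2 hb23] at h2

/-- **Triplication, second kind (`3a+b=2`, any `a, b > 0`).**
`(1-2a)•β(a,b) = 3^{b-1} • [((1-3a)/3)•β(2a, b/3) + ((1+3a)/3)•β(2a, (b+2)/3)]` in `Q` — derived
inside the rules from one substitution, ONE Newton–Leibniz move and two additivity splits. -/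
theorem betaQ_tripl1_second (a b : ℚ) (ha : 0 < a) (hb : 0 < b) (h : 3 * a + b = 2) :
    ((1 - 2 * a : ℚ) : K₀) • betaQ a b = triCoeff b •
      ((((1 - 3 * a) / 3 : ℚ) : K₀) • betaQ (2 * a) (b / 3) +
        (((1 + 3 * a) / 3 : ℚ) : K₀) • betaQ (2 * a) ((b + 2) / 3)) := by
  rw [betaQ_eq_triCoeff_smul_P a b ha hb h, ← mkQ_triWRep1 a b ha hb,
    eq_neg_of_add_eq_zero_right (triP1_add_triW1_eq_zero a b ha hb h), smul_neg]
  simp only [smul_smul, ← neg_smul]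
  congr 1
  push_cast
  ring

/-- **Level 9, second kind**: `(1/9)•β(4/9, 2/3) = 3^{-1/3} • [(-1/9)•β(8/9, 2/9) + (7/9)•β(8/9, 8/9)]`,
merging the second-kind orbits `{4,6,8}` and `{8,8,2}` (Deligne–Koblitz–Ogus at `N = 9`). -/
theorem betaQ_tripl_nine_468 :
    ((1 / 9 : ℚ) : K₀) • betaQ (4 / 9) (2 / 3) = triCoeff (2 / 3) •
      (((-1 / 9 : ℚ) : K₀) • betaQ (8 / 9) (2 / 9) + ((7 / 9 : ℚ) : K₀) • betaQ (8 / 9) (8 / 9)) := by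
  have h := betaQ_tripl1_second (4 / 9) (2 / 3) (by norm_num) (by norm_num) (by norm_num)
  rw [show (1 : ℚ) - 2 * (4 / 9) = 1 / 9 by norm_num, show (2 : ℚ) * (4 / 9) = 8 / 9 by norm_num,
    show (2 / 3 : ℚ) / 3 = 2 / 9 by norm_num, show ((2 / 3 : ℚ) + 2) / 3 = 8 / 9 by norm_num,
    show ((1 : ℚ) - 3 * (4 / 9)) / 3 = -1 / 9 by norm_num,
    show ((1 : ℚ) + 3 * (4 / 9)) / 3 = 7 / 9 by norm_num] at h
  exact h

end SoloBlind

end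

end Summit.KontsevichZagierPeriods.KontsevichZagierPeriods.Theorems
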